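import Summits.Ventures.Crystal3D.Theorems.StickyWulffConstantCoaxialWallLawPayerTransPlaneTwoPlate
import Summits.Ventures.Crystal3D.Theorems.StickyWulffConstantCoaxialWallLawPayerTransTwoPlate
import Summits.Ventures.Crystal3D.Theorems.StickyWulffConstantCoaxialWallLawPayerTwinTwoPlate
import Summits.Ventures.Crystal3D.Theorems.StickyWulffConstantCoaxialWallLawPayerUnion
import HarnessLib

/-!
# Branch F census-free X: the UNION RE-CUT — `stub_coaxialTwoSlabAdhesion`'s inequality and the crux `CoaxialWallLaw`'s
# statement at the uniform TWO-PLATE charge `√6/78` in place of `½`, for EVERY co-axial pair, modulo `KissingGap δ`,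
# `KissingClassification δ` ONLY

HONEST FRAMING. Venture `Summits/Ventures/Crystal3D` (cell `crystal3d-full`), helper `--supports` the crux
`CoaxialWallLaw` (stmt-Ventures-19481) of `route-Ventures-StickyWulffConstant`, REGISTERED line `WallLedgerF`
(planner cf-p1; stubs `stub_affineSampleDeficit`, `stub_coaxialTwoSlabAdhesion` of `…WallLedgerFDefs`).
RUNG CREDIT ONLY; F-C1 not moved; the crux (charge `½·sin θ`) is NOT closed here.

WHY THIS FILE.  The standing census-free law of record is `coaxialWallLaw_censusFree` (`…PayerUnion`, 19481-p2 g4: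
`1/156`, one plate, single sharp slot).  Planner (xxv) TWO-PLATE charging with ALL root families is now in the kernel for
every class of the co-axial dichotomy / skew trichotomy: twins `√6/78` (`…PayerTwinTwoPlate`), 3-adically generic
translations `φ₁/39` (`…PayerTransTwoPlate`), plane-coset translations of kinds (B) (doubly skew cubic axis, four
roots) and (C) (skew `{111}` plane, three in-plane roots) `(√6/78)·sin θ'` (`…PayerTransPlaneTwoPlate`).  This file is
the union, the text of `…PayerUnion` with `1/156 ↦ √6/78`:

* `exists_axis_twoPhi_ge` — for EVERY orientation the defender has a lattice frame `L'` with `√6·sin θ' ≤ 2φ₁`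
  (the four-root flux lemma `exists_axisRoots_sine` of `…SkewAxisMulti`, whose offset hypothesis is bookkeeping only
  for this purpose and is instantiated at a dummy offset; `RT ⊆` rising slots and `√2·Σ_rising = 2φ₁`): makes the
  orientation-free generic law `φ₁/39` dominate `(√6/78)·sin θ'`.
* `coaxialTwoSlabAdhesion_translate_twoPlate` — translation pairs, for SOME frame: (A) generic ⇒ `φ₁/39 ≥ (√6/78)·sin θ'`
  for the re-picked axis; (B) ⇒ `translate_twoSlabAdhesion_axis_twoPlate`; (C) ⇒ `coaxialTwoSlabAdhesion_trans_skew_twoPlate`.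
* **`coaxialTwoSlabAdhesion_censusFree_twoPlate`** — the text of `CoaxialTwoSlabAdhesion` with `(1 / 2 : ℝ) ↦
  (Real.sqrt 6 / 78 : ℝ)`: EVERY co-axial pair of distinct moved fcc lattices, arbitrary fillings, no residual.
* **`coaxialWallLaw_censusFree_twoPlate`** — the crux's statement VERBATIM with `(1 / 2 : ℝ) ↦ (Real.sqrt 6 / 78 : ℝ)`
  (`≈ 0.0314`, ×4.9 over `1/156`), modulo `KissingGap δ`, `KissingClassification δ` ONLY, by the charge-uniform
  composition `coaxialWallLaw_at_of_adhesion_at`.  «Every wall between two distinct co-axial fcc grains costs at least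
  `(√6/78)·sin θ` per unit area beyond the two free surfaces, for the defender's axis, uniformly in the thickness and
  the filling.»  The remaining factor `78/(2√6)·… ≈ 16` to `½` is the family-blind end multiplicity `78` (memo
  F-NEXT-SPEC §S2/§S4: census material), not the flux, which is now exact for every class.

WHAT THIS IS NOT: the stub or the crux (constant `½`); no census row; F-C1 not moved.
-/

noncomputable section

namespace Summit.Ventures.Crystal3D.Theorems

open Summit.Ventures.Crystal3D Finset Real NearIdentity
open Summit.Ventures.Crystal3D.Cruxes.CoaxialWallLaw.WallLedgerF (AffineSampleDeficit)
open Literature.MathematicalPhysics.StatisticalMechanics (fccStacking barlowStacking IsHaggSeq constHagg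
  isHaggSeq_const contactDeficiency)
open scoped InnerProductSpace

open scoped Classical in
/-- **The defender's axis for the generic class.**  For every orientation `A` there is a frame `L'` of the same lattice
with `√6 · √(1 − ⟪L' e₃, e₃⟫²) ≤ 2φ₁ = √2 · Σ_{rising} (A r)₂` (the four-root flux of `exists_axisRoots_sine` at a
dummy offset, dominated by the full rising flux). -/
theorem exists_axis_twoPhi_ge (A : EuclideanSpace ℝ (Fin 3) ≃ₗᵢ[ℝ] EuclideanSpace ℝ (Fin 3)) :
    ∃ L' : EuclideanSpace ℝ (Fin 3) ≃ₗᵢ[ℝ] EuclideanSpace ℝ (Fin 3),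
      L' '' fccStacking 1 (Real.sqrt (2 / 3)) = A '' fccStacking 1 (Real.sqrt (2 / 3)) ∧
      Real.sqrt 6 * Real.sqrt (1 - ⟪L' (EuclideanSpace.single (2 : Fin 3) (1 : ℝ)),
          EuclideanSpace.single (2 : Fin 3) (1 : ℝ)⟫_ℝ ^ 2) ≤
        2 * (Real.sqrt 2 / 4 * ∑ᶠ w ∈ {w ∈ fccStacking 1 (Real.sqrt (2 / 3)) | ‖w‖ = 1},
          |⟪w, A.symm (EuclideanSpace.single (2 : Fin 3) (1 : ℝ))⟫_ℝ|) := by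
  -- a dummy offset, doubly skew on the cubic axis `0`: `p = (1/4, 0, 0)`
  set τ₀ : EuclideanSpace ℝ (Fin 3) := (Real.sqrt 2 / 8) • cubicFrame 0 with hτ₀
  have hc : cubicCoords τ₀ = (Real.sqrt 2 / 8) • (Pi.single (0 : Fin 3) (1 : ℝ)) := by
    rw [hτ₀, cubicCoords_smul, cubicCoords_cubicFrame]
  have hs2 : Real.sqrt 2 * (Real.sqrt 2 / 8) = 1 / 4 := by
    have : Real.sqrt 2 ^ 2 = 2 := Real.sq_sqrt (by norm_num)
    nlinarith [this]
  have hquarter : ¬ ∃ z : ℤ, (1 / 4 : ℝ) = z := by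
    rintro ⟨z, hz⟩
    have h4 : ((4 * z : ℤ) : ℝ) = ((1 : ℤ) : ℝ) := by push_cast; linarith
    have := (Int.cast_inj (α := ℝ)).1 h4
    omega
  have hk : ∀ i : Fin 3, i ≠ 0 →
      (¬ ∃ z : ℤ, Real.sqrt 2 * cubicCoords τ₀ 0 + Real.sqrt 2 * cubicCoords τ₀ i = z) ∧
      (¬ ∃ z : ℤ, Real.sqrt 2 * cubicCoords τ₀ 0 - Real.sqrt 2 * cubicCoords τ₀ i = z) := by
    intro i hi
    have h0 : cubicCoords τ₀ 0 = Real.sqrt 2 / 8 := by rw [hc]; simp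
    have hi' : cubicCoords τ₀ i = 0 := by rw [hc]; simp [hi]
    rw [h0, hi', hs2, mul_zero, add_zero, sub_zero]
    exact ⟨hquarter, hquarter⟩
  obtain ⟨RT, hRT, -, L', hL', hflux⟩ := exists_axisRoots_sine τ₀ 0 hk A
  refine ⟨L', hL', ?_⟩
  -- `Σ_{RT} ≤ Σ_{rising}` and `√2 Σ_{rising} = 2φ₁`
  have hsub : RT ⊆ fccSlots.filter (fun r => 0 < (A r) 2) := fun r hr => mem_filter.2 (hRT r hr)
  have hle : ∑ r ∈ RT, (A r) 2 ≤ ∑ r ∈ fccSlots.filter (fun r => 0 < (A r) 2), (A r) 2 :=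
    sum_le_sum_of_subset_of_nonneg hsub fun r hr _ => (mem_filter.1 hr).2.le
  rw [← sqrt_two_mul_sum_rising_eq_two_phi A, show (6 : ℝ) = 2 * 3 by norm_num,
    Real.sqrt_mul (by norm_num : (0 : ℝ) ≤ 2), mul_assoc]
  exact mul_le_mul_of_nonneg_left (hflux.trans hle) (Real.sqrt_nonneg _)

section CensusFree

variable {δ : ℝ} (hg : KissingGap δ) (hc : KissingClassification δ)
include hg hc

open scoped Classical in
/-- **Census-free TRANSLATION pairs, two plates** (`A₁·Λ₀ = A₂·Λ₀`, `Λ₁ ≠ Λ₂`): for SOME frame, charge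
`(√6/78)·sin θ`, modulo `KissingGap δ`, `KissingClassification δ` only.  See the module docstring. -/
theorem coaxialTwoSlabAdhesion_translate_twoPlate
    (A₁ : EuclideanSpace ℝ (Fin 3) ≃ₗᵢ[ℝ] EuclideanSpace ℝ (Fin 3)) (t₁ : EuclideanSpace ℝ (Fin 3))
    (A₂ : EuclideanSpace ℝ (Fin 3) ≃ₗᵢ[ℝ] EuclideanSpace ℝ (Fin 3)) (t₂ : EuclideanSpace ℝ (Fin 3))
    (htrans : A₁ '' fccStacking 1 (Real.sqrt (2 / 3)) = A₂ '' fccStacking 1 (Real.sqrt (2 / 3)))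
    (hne : (fun p => A₁ p + t₁) '' fccStacking 1 (Real.sqrt (2 / 3)) ≠
      (fun p => A₂ p + t₂) '' fccStacking 1 (Real.sqrt (2 / 3))) :
    ∃ (L : EuclideanSpace ℝ (Fin 3) ≃ₗᵢ[ℝ] EuclideanSpace ℝ (Fin 3))
        (s₁ s₂ : EuclideanSpace ℝ (Fin 3)) (σ σ' : ℤ → ℤ), IsHaggSeq σ ∧ IsHaggSeq σ' ∧
        (fun p => A₁ p + t₁) '' fccStacking 1 (Real.sqrt (2 / 3)) ⊆
          (fun p => L p + s₁) '' barlowStacking 1 (Real.sqrt (2 / 3)) σ ∧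
        (fun p => A₂ p + t₂) '' fccStacking 1 (Real.sqrt (2 / 3)) ⊆
          (fun p => L p + s₂) '' barlowStacking 1 (Real.sqrt (2 / 3)) σ' ∧
    ∃ C R₀ : ℝ, 1 ≤ R₀ ∧ ∀ h : ℝ, 0 ≤ h → ∀ ρ : ℝ, R₀ ≤ ρ →
      ∀ X P₁ P₂ : Finset (EuclideanSpace ℝ (Fin 3)),
      (∀ p ∈ X, ∀ q ∈ X, p ≠ q → 1 ≤ dist p q) → P₁ ⊆ X → P₂ ⊆ X \ P₁ →
      (∀ p ∈ X, -(2 * R₀) ≤ p 2 ∧ p 2 ≤ h + 2 * R₀ ∧ p 0 ^ 2 + p 1 ^ 2 ≤ ρ ^ 2) →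
      (∀ p, p ∈ P₁ ↔ (p ∈ (fun q => A₁ q + t₁) '' fccStacking 1 (Real.sqrt (2 / 3)) ∧
        -(2 * R₀) ≤ p 2 ∧ p 2 ≤ -R₀ ∧ p 0 ^ 2 + p 1 ^ 2 ≤ ρ ^ 2)) →
      (∀ p, p ∈ P₂ ↔ (p ∈ (fun q => A₂ q + t₂) '' fccStacking 1 (Real.sqrt (2 / 3)) ∧
        h + R₀ ≤ p 2 ∧ p 2 ≤ h + 2 * R₀ ∧ p 0 ^ 2 + p 1 ^ 2 ≤ ρ ^ 2)) →
      ((((P₁ ×ˢ (X \ P₁)).filter fun pq => dist pq.1 pq.2 = 1).card : ℕ) : ℝ) +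
        ((((P₂ ×ˢ ((X \ P₁) \ P₂)).filter fun pq => dist pq.1 pq.2 = 1).card : ℕ) : ℝ) ≤
        contactDeficiency ((X \ P₁) \ P₂) +
          (Real.sqrt 2 / 4 * ∑ᶠ w ∈ {w ∈ fccStacking 1 (Real.sqrt (2 / 3)) | ‖w‖ = 1},
              |⟪w, A₁.symm (EuclideanSpace.single (2 : Fin 3) (1 : ℝ))⟫_ℝ| +
            Real.sqrt 2 / 4 * ∑ᶠ w ∈ {w ∈ fccStacking 1 (Real.sqrt (2 / 3)) | ‖w‖ = 1},
              |⟪w, A₂.symm (EuclideanSpace.single (2 : Fin 3) (1 : ℝ))⟫_ℝ| -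
            (Real.sqrt 6 / 78 : ℝ) * Real.sqrt (1 - ⟪L (EuclideanSpace.single (2 : Fin 3) (1 : ℝ)),
              (EuclideanSpace.single (2 : Fin 3) (1 : ℝ))⟫_ℝ ^ 2)) * Real.pi * ρ ^ 2 +
          C * (1 + h) * ρ := by
  set e₃ : EuclideanSpace ℝ (Fin 3) := EuclideanSpace.single (2 : Fin 3) (1 : ℝ) with he₃
  set τ : EuclideanSpace ℝ (Fin 3) := A₁.symm (t₂ - t₁) with hτ
  have hτΛ : τ ∉ fccStacking 1 (Real.sqrt (2 / 3)) := offset_notMem_of_ne A₁ A₂ t₁ t₂ htrans hne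
  have hπρ : ∀ ρ : ℝ, 0 ≤ Real.pi * ρ ^ 2 := fun ρ => by positivity
  have hΛ₂ : A₂ '' fccStacking 1 (Real.sqrt (2 / 3)) = A₁ '' fccStacking 1 (Real.sqrt (2 / 3)) := htrans.symm
  rcases skew_trichotomy_fin τ with hall | ⟨k, hk⟩ | ⟨c, hcube⟩
  · -- (A) generic offset: orientation-free `φ₁/39`, which dominates `(√6/78)·sin θ'` for the re-picked axis
    obtain ⟨C, R₀, hR₀, hmain⟩ := translate_twoSlabAdhesion_generic_twoPlate hg hc A₁ t₁ A₂ t₂ htrans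
      (fun k => generic_of_allInt τ hall hτΛ k)
    obtain ⟨L', hL', hphi⟩ := exists_axis_twoPhi_ge A₁
    refine ⟨L', t₁, t₂, constHagg, constHagg, isHaggSeq_const, isHaggSeq_const,
      movedFcc_subset_frame_of_image_eq A₁ L' t₁ hL'.symm,
      movedFcc_subset_frame_of_image_eq A₂ L' t₂ (hΛ₂.trans hL'.symm), C, R₀, hR₀, ?_⟩
    intro h hh ρ hρ X P₁ P₂ hX hP₁X hP₂X₁ hcyl hP₁ hP₂
    have key := hmain h hh ρ hρ X P₁ P₂ hX hP₁X hP₂X₁ hcyl hP₁ hP₂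
    have hc' : Real.sqrt 6 / 78 * Real.sqrt (1 - ⟪L' e₃, e₃⟫_ℝ ^ 2) ≤
        (Real.sqrt 2 / 4 * ∑ᶠ w ∈ {w ∈ fccStacking 1 (Real.sqrt (2 / 3)) | ‖w‖ = 1}, |⟪w, A₁.symm e₃⟫_ℝ|) / 39 := by
      linarith only [hphi]
    have := mul_le_mul_of_nonneg_right hc' (hπρ ρ)
    linarith only [key, this]
  · -- (B) a doubly skew axis: the four axis roots and the re-picked axis `L'`
    obtain ⟨L', hL', C, R₀, hR₀, hmain⟩ := translate_twoSlabAdhesion_axis_twoPlate hg hc A₁ t₁ A₂ t₂ htrans k hk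
    exact ⟨L', t₁, t₂, constHagg, constHagg, isHaggSeq_const, isHaggSeq_const,
      movedFcc_subset_frame_of_image_eq A₁ L' t₁ hL'.symm,
      movedFcc_subset_frame_of_image_eq A₂ L' t₂ (hΛ₂.trans hL'.symm), C, R₀, hR₀, hmain⟩
  · -- (C) a skew `{111}` plane: the defender's frame `L'`, three in-plane roots
    obtain ⟨L', hL', hskew⟩ := exists_skewFrame_of_cube A₁ τ c hcube
    obtain ⟨C, R₀, hR₀, hmain⟩ := coaxialTwoSlabAdhesion_trans_skew_twoPlate hg hc A₁ t₁ A₂ t₂ L' hL' htrans hskew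
    exact ⟨L', t₁, t₂, constHagg, constHagg, isHaggSeq_const, isHaggSeq_const,
      movedFcc_subset_frame_of_image_eq A₁ L' t₁ hL'.symm,
      movedFcc_subset_frame_of_image_eq A₂ L' t₂ (hΛ₂.trans hL'.symm), C, R₀, hR₀, hmain⟩

/-- **THE INEQUALITY OF `stub_coaxialTwoSlabAdhesion` AT THE UNIFORM TWO-PLATE CHARGE `√6/78`, CENSUS-FREE.**  The text
of `CoaxialTwoSlabAdhesion` (`…WallLedgerFDefs`) with `(1 / 2 : ℝ) ↦ (Real.sqrt 6 / 78 : ℝ)`: every co-axial pair of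
distinct moved fcc lattices, arbitrary fillings; modulo `KissingGap δ`, `KissingClassification δ` ONLY.  See the module
docstring. -/
theorem coaxialTwoSlabAdhesion_censusFree_twoPlate :
    ∀ (A₁ : EuclideanSpace ℝ (Fin 3) ≃ₗᵢ[ℝ] EuclideanSpace ℝ (Fin 3)) (t₁ : EuclideanSpace ℝ (Fin 3))
      (A₂ : EuclideanSpace ℝ (Fin 3) ≃ₗᵢ[ℝ] EuclideanSpace ℝ (Fin 3)) (t₂ : EuclideanSpace ℝ (Fin 3)),
    (∃ (L : EuclideanSpace ℝ (Fin 3) ≃ₗᵢ[ℝ] EuclideanSpace ℝ (Fin 3))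
        (s₁ s₂ : EuclideanSpace ℝ (Fin 3)) (σ σ' : ℤ → ℤ), IsHaggSeq σ ∧ IsHaggSeq σ' ∧
        (fun p => A₁ p + t₁) '' fccStacking 1 (Real.sqrt (2 / 3)) ⊆
          (fun p => L p + s₁) '' barlowStacking 1 (Real.sqrt (2 / 3)) σ ∧
        (fun p => A₂ p + t₂) '' fccStacking 1 (Real.sqrt (2 / 3)) ⊆
          (fun p => L p + s₂) '' barlowStacking 1 (Real.sqrt (2 / 3)) σ') →
    (fun p => A₁ p + t₁) '' fccStacking 1 (Real.sqrt (2 / 3)) ≠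
      (fun p => A₂ p + t₂) '' fccStacking 1 (Real.sqrt (2 / 3)) →
    ∃ (L : EuclideanSpace ℝ (Fin 3) ≃ₗᵢ[ℝ] EuclideanSpace ℝ (Fin 3))
        (s₁ s₂ : EuclideanSpace ℝ (Fin 3)) (σ σ' : ℤ → ℤ), IsHaggSeq σ ∧ IsHaggSeq σ' ∧
        (fun p => A₁ p + t₁) '' fccStacking 1 (Real.sqrt (2 / 3)) ⊆
          (fun p => L p + s₁) '' barlowStacking 1 (Real.sqrt (2 / 3)) σ ∧
        (fun p => A₂ p + t₂) '' fccStacking 1 (Real.sqrt (2 / 3)) ⊆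
          (fun p => L p + s₂) '' barlowStacking 1 (Real.sqrt (2 / 3)) σ' ∧
    ∃ C R₀ : ℝ, 1 ≤ R₀ ∧ ∀ h : ℝ, 0 ≤ h → ∀ ρ : ℝ, R₀ ≤ ρ →
      ∀ X P₁ P₂ : Finset (EuclideanSpace ℝ (Fin 3)),
      (∀ p ∈ X, ∀ q ∈ X, p ≠ q → 1 ≤ dist p q) → P₁ ⊆ X → P₂ ⊆ X \ P₁ →
      (∀ p ∈ X, -(2 * R₀) ≤ p 2 ∧ p 2 ≤ h + 2 * R₀ ∧ p 0 ^ 2 + p 1 ^ 2 ≤ ρ ^ 2) →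
      (∀ p, p ∈ P₁ ↔ (p ∈ (fun q => A₁ q + t₁) '' fccStacking 1 (Real.sqrt (2 / 3)) ∧
        -(2 * R₀) ≤ p 2 ∧ p 2 ≤ -R₀ ∧ p 0 ^ 2 + p 1 ^ 2 ≤ ρ ^ 2)) →
      (∀ p, p ∈ P₂ ↔ (p ∈ (fun q => A₂ q + t₂) '' fccStacking 1 (Real.sqrt (2 / 3)) ∧
        h + R₀ ≤ p 2 ∧ p 2 ≤ h + 2 * R₀ ∧ p 0 ^ 2 + p 1 ^ 2 ≤ ρ ^ 2)) →
      ((((P₁ ×ˢ (X \ P₁)).filter fun pq => dist pq.1 pq.2 = 1).card : ℕ) : ℝ) +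
        ((((P₂ ×ˢ ((X \ P₁) \ P₂)).filter fun pq => dist pq.1 pq.2 = 1).card : ℕ) : ℝ) ≤
        contactDeficiency ((X \ P₁) \ P₂) +
          (Real.sqrt 2 / 4 * ∑ᶠ w ∈ {w ∈ fccStacking 1 (Real.sqrt (2 / 3)) | ‖w‖ = 1},
              |⟪w, A₁.symm (EuclideanSpace.single (2 : Fin 3) (1 : ℝ))⟫_ℝ| +
            Real.sqrt 2 / 4 * ∑ᶠ w ∈ {w ∈ fccStacking 1 (Real.sqrt (2 / 3)) | ‖w‖ = 1},
              |⟪w, A₂.symm (EuclideanSpace.single (2 : Fin 3) (1 : ℝ))⟫_ℝ| -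
            (Real.sqrt 6 / 78 : ℝ) * Real.sqrt (1 - ⟪L (EuclideanSpace.single (2 : Fin 3) (1 : ℝ)),
              (EuclideanSpace.single (2 : Fin 3) (1 : ℝ))⟫_ℝ ^ 2)) * Real.pi * ρ ^ 2 +
          C * (1 + h) * ρ := by
  classical
  intro A₁ t₁ A₂ t₂ hcoax hne
  obtain ⟨L, s₁, s₂, σ, σ', hσ, hσ', hsub₁, hsub₂⟩ := hcoax
  by_cases htrans : A₁ '' fccStacking 1 (Real.sqrt (2 / 3)) = A₂ '' fccStacking 1 (Real.sqrt (2 / 3))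
  · exact coaxialTwoSlabAdhesion_translate_twoPlate hg hc A₁ t₁ A₂ t₂ htrans hne
  · -- twin pair: the two-plate twin law `√6/78` (`…PayerTwinTwoPlate`), frame `L`
    obtain ⟨C, R₀, hR₀, hmain⟩ := coaxialTwoSlabAdhesion_general_twin_twoPlate hg hc A₁ t₁ A₂ t₂ L s₁ s₂ σ σ'
      hσ hσ' hsub₁ hsub₂ htrans
    exact ⟨L, s₁, s₂, σ, σ', hσ, hσ', hsub₁, hsub₂, C, R₀, hR₀, hmain⟩

end CensusFree

/-- **THE CRUX `CoaxialWallLaw` VERBATIM AT THE UNIFORM TWO-PLATE CHARGE `√6/78` IN PLACE OF `½`, CENSUS-FREE** — for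
EVERY co-axial pair of distinct moved fcc lattices, modulo `KissingGap δ`, `KissingClassification δ` ONLY (admissible; no
E1 row, no `KFoldTopDeficit`).  F's standing law of record after the two-plate re-cut (×4.9 over
`coaxialWallLaw_censusFree`).  See the module docstring. -/
theorem coaxialWallLaw_censusFree_twoPlate {δ : ℝ} (hg : KissingGap δ) (hc : KissingClassification δ) :
    ∀ (A₁ : EuclideanSpace ℝ (Fin 3) ≃ₗᵢ[ℝ] EuclideanSpace ℝ (Fin 3)) (t₁ : EuclideanSpace ℝ (Fin 3))
      (A₂ : EuclideanSpace ℝ (Fin 3) ≃ₗᵢ[ℝ] EuclideanSpace ℝ (Fin 3)) (t₂ : EuclideanSpace ℝ (Fin 3)),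
    (∃ (L : EuclideanSpace ℝ (Fin 3) ≃ₗᵢ[ℝ] EuclideanSpace ℝ (Fin 3)) (s₁ s₂ : EuclideanSpace ℝ (Fin 3))
        (σ σ' : ℤ → ℤ), IsHaggSeq σ ∧ IsHaggSeq σ' ∧
        (fun p => A₁ p + t₁) '' fccStacking 1 (Real.sqrt (2 / 3)) ⊆
          (fun p => L p + s₁) '' barlowStacking 1 (Real.sqrt (2 / 3)) σ ∧
        (fun p => A₂ p + t₂) '' fccStacking 1 (Real.sqrt (2 / 3)) ⊆
          (fun p => L p + s₂) '' barlowStacking 1 (Real.sqrt (2 / 3)) σ') →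
    (fun p => A₁ p + t₁) '' fccStacking 1 (Real.sqrt (2 / 3)) ≠
      (fun p => A₂ p + t₂) '' fccStacking 1 (Real.sqrt (2 / 3)) →
    ∃ (L : EuclideanSpace ℝ (Fin 3) ≃ₗᵢ[ℝ] EuclideanSpace ℝ (Fin 3)) (s₁ s₂ : EuclideanSpace ℝ (Fin 3))
        (σ σ' : ℤ → ℤ), IsHaggSeq σ ∧ IsHaggSeq σ' ∧
        (fun p => A₁ p + t₁) '' fccStacking 1 (Real.sqrt (2 / 3)) ⊆
          (fun p => L p + s₁) '' barlowStacking 1 (Real.sqrt (2 / 3)) σ ∧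
        (fun p => A₂ p + t₂) '' fccStacking 1 (Real.sqrt (2 / 3)) ⊆
          (fun p => L p + s₂) '' barlowStacking 1 (Real.sqrt (2 / 3)) σ' ∧
    ∃ C R₀ : ℝ, 0 < R₀ ∧ ∀ h : ℝ, 0 ≤ h → ∀ ρ : ℝ, R₀ ≤ ρ →
      ∀ (N : ℕ) (x : Fin N → EuclideanSpace ℝ (Fin 3)), Summit.Ventures.Crystal3D.IsUnitPacking x →
      (∀ i, -(2 * R₀) ≤ x i 2 ∧ x i 2 ≤ h + 2 * R₀ ∧ x i 0 ^ 2 + x i 1 ^ 2 ≤ ρ ^ 2) →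
      (∀ p ∈ (fun p => A₁ p + t₁) '' fccStacking 1 (Real.sqrt (2 / 3)),
        (-(2 * R₀) ≤ p 2 ∧ p 2 ≤ -R₀ ∧ p 0 ^ 2 + p 1 ^ 2 ≤ ρ ^ 2) → ∃ i, x i = p) →
      (∀ p ∈ (fun p => A₂ p + t₂) '' fccStacking 1 (Real.sqrt (2 / 3)),
        (h + R₀ ≤ p 2 ∧ p 2 ≤ h + 2 * R₀ ∧ p 0 ^ 2 + p 1 ^ 2 ≤ ρ ^ 2) → ∃ i, x i = p) →
      (Real.sqrt 2 / 4 * ∑ᶠ w ∈ {w ∈ fccStacking 1 (Real.sqrt (2 / 3)) | ‖w‖ = 1},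
          |⟪w, A₁.symm (EuclideanSpace.single (2 : Fin 3) (1 : ℝ))⟫_ℝ| +
        Real.sqrt 2 / 4 * ∑ᶠ w ∈ {w ∈ fccStacking 1 (Real.sqrt (2 / 3)) | ‖w‖ = 1},
          |⟪w, A₂.symm (EuclideanSpace.single (2 : Fin 3) (1 : ℝ))⟫_ℝ| +
        (Real.sqrt 6 / 78 : ℝ) * Real.sqrt (1 - ⟪L (EuclideanSpace.single (2 : Fin 3) (1 : ℝ)),
          (EuclideanSpace.single (2 : Fin 3) (1 : ℝ))⟫_ℝ ^ 2)) * Real.pi * ρ ^ 2 - C * (1 + h) * ρ ≤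
        6 * (N : ℝ) - (Summit.Ventures.Crystal3D.numContacts x : ℝ) :=
  coaxialWallLaw_at_of_adhesion_at (Real.sqrt 6 / 78 : ℝ) Summit.Ventures.Crystal3D.Theorems.stub_affineSampleDeficit
    (coaxialTwoSlabAdhesion_censusFree_twoPlate hg hc)

end Summit.Ventures.Crystal3D.Theorems

end
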